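import Literature.MathematicalPhysics.QuantumFieldTheory.Balaban1983to89.Node00.Carriers3
import Literature.MathematicalPhysics.QuantumFieldTheory.Balaban1983to89.Node00.WorldFrame
import Literature.MathematicalPhysics.QuantumFieldTheory.Balaban1983to89.B12Lemma4ConcreteFrame
import Literature.MathematicalPhysics.QuantumFieldTheory.Balaban1983to89.B12StepObligation
import Literature.MathematicalPhysics.QuantumFieldTheory.Balaban1983to89.B12BetaSmooth
import Literature.MathematicalPhysics.QuantumFieldTheory.Balaban1983to89.B12BetaHolo
import Literature.MathematicalPhysics.QuantumFieldTheory.Balaban1983to89.B13NodeTorusFamily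

/-!
# NODE N09 · [Balaban1987RG1] — the DAG node `Dag.B12_main` KNIT BY NAME: conjunct 1 (Sects. 2–5 = Lemma 4 p. 280) DISCHARGED at
# every run whose carrier bundle pins the B12 group to a concrete Lemma-4 frame; conjunct 2 («Thm 3 ⇐ the remaining properties»,
# p. 269) REDUCED to named hypotheses on the construction of record, in the tree's three vocabularies

T. Bałaban, *Renormalization group approach to lattice gauge field theories. I*, Commun. Math. Phys. **109** (1987) 249–301
[Balaban1987RG1] (cell paper B12 = «[I]»; PDF page = journal page − 248) and *II. Cluster expansions*, **116** (1988) 1–22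
[Balaban1988RG2Cluster] (B13 = «[II]»).  TRACK A (YM-PLAN §2b, node N09 of 28), seat `pub-ymgap-dag-n09-a` (prover, KNIT-BY-NAME; HUMAN
RULING D-0062; chair R429; dag-lead NODE-TABLE v1 row n09: «-a: knit conjunct 1 by name + conjunct 2 as hypothesis (C-bound until Stage 5)»).
THEOREMS ONLY, def-free, sorry-free, standard axioms.  EVERYTHING MATHEMATICAL BELOW IS AN EXISTING KERNEL THEOREM OF THE TREE, USED BY
NAME; this module is the referee-facing assembly of the node and moves no count by itself.

## THE NODE (`…Balaban1983to89.Dag` :212; venue `HOME/lean/ym-dag/N09_B12.lean`: `YMDAG.N09 w P := Dag.B12_main (DagBinding.leavesP w P)`)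

  `B12_main ℓ := ℓ.b4 → ℓ.b5 → ℓ.b6 → ℓ.b7 → ℓ.b8 → ℓ.b9 → ℓ.b10 → ℓ.b11 → (ℓ.b12 ∧ (ℓ.b12 → ℓ.b13 → (ℓ.smallCouplings → ℓ.smallFieldInductive)))`

read at `ℓ := DagBinding.leavesP w P`: in-edges `b4 … b11` (N01–N08), `b13` (N10); OWN LEAF `b12 := (w.up P).b12`, which at the N-binding
`DagBinding.Upstream.ofPrintedAllXPN X Y Z V W` of the worlds of record is `B12Sec2to5.Lemma4Printed X.F12 X.c12` — **Lemma 4 (3.53) p. 280**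
over the bundle's B12 group (`b12_leaf_eq`, `rfl`); and the Theorem-3 clause `smallCouplings → smallFieldInductive` =
`(w.C P).flow.InInterval w.γ P.K → ∀ k ≤ P.K, (w.C P).IndAss k` — **Theorem 1 p. 259 ∕ Theorem 3 p. 264 for the run `P` of the
construction `w.C`** under the interval hypothesis (`Node00.b12_main_iff`, `Iff.rfl`).

## WHAT IS PINNED TODAY AND WHAT IS NOT (the located reason this knit is PARAMETRIC — R422 typing policy)

NODE 00 Stages 1–3 (`Node00.Carriers`, `.Carriers2`, `.Carriers3`) pin the B4, B5, B7 and (k-level) B6 groups of the run's bundle; the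
B12 group `(F12, c12)` is the run's OWN (`carriers₃_groupB12`, `rfl`) and the construction `w.C` is unconstrained until Stage 5
(`Node00.WorldFrame` §4: with `IndAss ≡ True` the Theorem-3 clause is contentless, `Node00.b12_main_iff_of_trivial_indAss`).  Hence N09 is
neither dischargeable nor refutable «at the objects of record» of Stage ≤ 3 (§4: at a Stage-3 run it IS «Lemma 4 on the run's free frame ∧
the C-half», `b12_main_iff_of_up_carriers₃`).  This module therefore states every theorem at a run `P` of a world `w` with the EXPLICIT
binding hypothesis `hP : w.up P = Upstream.ofPrintedAllXPN X Y Z V W` (the shape of `Node00.CarriersFrame` §3) plus the EXPLICIT pin of the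
B12 group to a concrete frame — `X.F12 = B12Lemma4ConcreteFrame.frameOf 𝓜 X.c12 D` for a package `D : Lemma4Data Q i 𝓜 X.c12` of the
by-reference inputs of the proof of Lemma 4 ([15] = [Balaban1985Variational] Prop. 9 ∕ Sect. G functions, pp. 275–280), equivalently
the structure-update form `{X with F12 := frameOf 𝓜 c D, c12 := c}` (`b12_leaf_update`) that a Stage-4∕5 `withB12OfRecord` (node00-def's
definition, not this seat's) will unfold to — so the world-level corollary over the Stage-5 record predicate is a one-liner from §2–§3.
NON-TRIVIALITY OF THE PACKAGE is NODE 00's to certify: `B12Lemma4DataInstance.lemma4Printed_trivData` shows a TRIVIAL package also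
inhabits `Lemma4Data` (dag-lead row n09: «NODE 00 must name the NON-trivial package»); this module is agnostic of `D`.

## WHAT THIS FILE PROVES (0 sorry; axioms {propext, Classical.choice, Quot.sound})

* §1 LEAF LEVEL — `b12_leaf_eq` (`rfl`), **`b12_leaf_of_frameOf`** ∕ **`b12_leaf_update`**: the `b12` leaf of the N-binding HOLDS at every bundle
  whose B12 group is a concrete Lemma-4 frame, by `B12Lemma4ConcreteFrame.lemma4Printed_frameOf` (Lemma 4 (3.53) + analyticity, p. 280;
  membership by `B12Lemma4Assembled.ofBackground_mem_space'_lemma4_of_upper_space`, analyticity by `B12CondIIIJConcreteModels.analyticAt_pair_lemma4`).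
* §2 RUN LEVEL, CONJUNCT 1 DISCHARGED — **`b12_main_iff_thm3_of_up_frameOf`**: at a pinned run, N09 ↔ «in-edges `b4 … b11`, `b13` → the
  Theorem-3 clause for `w.C P`» (its C-bound half EXACTLY); `b12_main_of_up_frameOf_of_thm3` (the clause as ONE hypothesis, literal form).
* §3 CONJUNCT 2 IN THE TREE'S VOCABULARIES (p. 269 *«Thus the proof of Theorem 3 is reduced to proving the remaining properties of (2.13)»*;
  [II] p. 22 *«hence the proof of Theorem I.3»*): **`b12_main_of_up_frameOf_of_smallFieldStep`** — first step `IndAss 0` + [II]'s node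
  `B13.SmallFieldStep` for the run GIVEN `b13` (`B13.indAss_all`); **`b12_main_of_up_frameOf_of_sec2`** — `IndAss 0` + the §2 reduction
  `B12Sec2to5.Sec2Reduction` + the new-term delivery `NewTermDelivered` GIVEN `b13` (`B12Sec2to5.smallFieldStep_of_sec2`);
  **`b12_main_of_up_frameOf_of_runDict`** — for a construction bound to a small-field tower by `B12StepObligation.RunDict`
  (`IndAss k ↔ Step.SFHyp T c k`, same flow, `c.γ = w.γ`): the first step is AUTOMATIC (`Step.SFHyp.zero`), the §2 reduction HOLDS
  (`B12StepObligation.sec2Reduction_holds`), and N09 follows from the per-step new-term obligations `SFHyp T c k → SFNewTerm T c k` (k < K,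
  couplings in the interval) GIVEN `b13` — the ONE remaining content; **`b12_main_of_up_frameOf_of_deliverables`** — that content assembled
  per step by `B12StepObligation.sfNewTerm_of_deliverables` from [II]'s `B13.Deliverables` (given the hypotheses at `k`) + the step dictionary
  `StepDict` + the world leaf `rgFlow` ((0.20) = (2.15)) + gauge invariance of the spaces (p. 263) + §5 (5.10)∕(5.42) (`Beta542Source`) + the
  UNSOURCED β-smoothness clause of p. 264 (`BetaSmoothAt`, cell GAPS G-b12-2 (ii)) — every input of conjunct 2 displayed by name.
* §2′ WORLD LEVEL — `b12_main_of_pinnedB12_of_thm3` ∕ `_of_smallFieldStep`: for a world whose upstream block is AT EVERY RUN the N-binding over a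
  bundle with the B12 group a concrete Lemma-4 frame (the shape of a Stage-4∕5 record predicate), N09 at every run from the C-half at every run —
  the venue slot `YMDAG.N09_holds (w) (hw) (P)` is then a one-liner.
* §4 STAGE-3 FRAME — `carriers₃_groupB12` (`rfl`) and `b12_main_iff_of_up_carriers₃`: at a run of a Stage-3 world of record N09 unfolds, with
  `b4 b5 b7` discharged (`Node00.carriers₁_b4 ∕ _b5`, `carriers₂_b7`), to «`b6 → b8 → b9 → b10 → b11 → (Lemma4Printed X.F12 X.c12 ∧ (… → b13 →
  C-half))`» over the run's FREE B12 group and the FREE construction — the in-edge VACUITY MAP of YM-PLAN §1 for N09 in kernel form.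

HONEST FRAMING: count-neutral knit; conjunct 2 stays a NAMED hypothesis on `w.C P` until NODE 00 Stage 5 defines the construction of
record (then (iii) is the shape to instantiate: `IndAss k := Step.SFHyp …`, report NODE00-SCOPING §2.12); [Balaban1987RG1] Theorem 2 (NODE O,
n25) is not touched; `B12.Thm3Printed` stays uninhabited (located negative on a sub-display: `B12ExpSteps.lemma4Restrictions_not_sufficient_341`).
One finite four-torus programme at fixed ε ([Balaban1989LargeFieldII] Thm 1 scope); NOT ℝ⁴, NOT infinite volume, NOT OS axioms, NOT a mass gap,
NOT the Clay problem.

v2 (append-only; v1 declarations byte-identical; + import `…B12BetaSmooth`): §5 — `spacesGaugeInvariant_of_space` (p. 263 «by the definition, gauge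
invariant» DISCHARGED for towers over `B12RegularSpaces111.space`, by `act_mem_space`); `b12_main_of_up_frameOf_of_deliverables_analytic` ((iv) in the
printed «(or analytic)» reading); `thm1Printed_of_b12_main` ∕ `thm3_inner_of_b12_main` (N09 at every run + in-edges ⇒ `B12.Thm1Printed w.C.toB12`).
v3 (append-only; v1∕v2 declarations byte-identical; + import `…B12BetaHolo`, seat g2): §6 — the β-SIDE of conjunct 2 from ONE holomorphic
polarization source per step: **`b12_main_of_up_frameOf_of_deliverables_piHolo`** ((iv″): the per-step inputs `hβ : Beta542Source` AND the
UNSOURCED `hsmooth : BetaSmoothAt` of (iv) both supplied by `B12BetaHolo.PiHoloSource T c k` — the (1.21) kernel holomorphic in the coupling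
with (5.10) on a complex neighbourhood of [0, γ], i.e. the p. 264 β-clause DERIVED in the p. 266 «(or analytic)» alternative, with explicit
k-uniform derivative constants); **`b12_main_of_up_frameOf_of_deliverables_space_piHolo`** ((iv‴): for towers over the concrete spaces
`B12RegularSpaces111.space` the p. 263 input `hsp` is discharged too (§5), so conjunct 2 at a pinned run follows from [II]'s deliverables
(N10, `hdel`) + the step dictionary + the world leaf `rgFlow` + ONE `PiHoloSource` per step — the census of what conjunct 2 still consumes).
v4 (append-only; v1–v3 declarations byte-identical): §7 — THE N10-JUNCTION FORM of conjunct 2 (cell item TS-3 «b13 per-run vs (k,g)-family»,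
dagwriter's word (R1): the B13 group becomes a HISTORY-indexed family with `b13 := ∀ k v ∈ Box, Lemmas 1–3 (S13 k v)`):
**`b12_main_of_up_frameOf_of_lemma3Family_piHolo`** — `hdel` of (iv‴) DERIVED, at every step `k < K` and every coupling `g ∈ ]0, γ]`, from
[II] LEMMA 3 for the step datum `S k g` (what the (R1) leaf delivers at the run's history with last coordinate `g`) + the printed closing
chain pp. 20–22 (`B13.deliverables_of_chain`: restrictions, the [26]-step `CammarotaStep`, R22–R24, the `log Z^{(k)}` half, (I.1.7),
analyticity, gauge invariance — each a per-(k,g) binder named by [II]), and, at the endpoint `g = 0` (where the remainder (2.13) vanishes,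
p. 268, and [II] is not invoked), an endpoint datum `Deliverables (S k 0)` supplied by the record.  This is the exact per-(k,g) leaf list N09
needs from N10 under (R1); when the re-typed leaf lands, `h3` below is its specialisation.
v5 (append-only; v1–v4 declarations byte-identical): §8 — the same junction WITHOUT an endpoint datum: **`b12_main_of_up_frameOf_of_lemma3Family_eHolo`**
((iv⁗′): at `g = 0` the bound (1.18) is obtained by CONTINUITY in the coupling from a holomorphic source for the new term, `B12BetaHolo.EHoloAt`
— `B12BetaHolo.sfNewTerm_of_deliverables_Ioc`; so conjunct 2 at a pinned run ⇐ per (k, g ∈ ]0, γ]) [II] Lemma 3 given b13 + the closing leaves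
+ dictionary + `rgFlow` + `0 < γ` + per step ONE `EHoloAt` and ONE `PiHoloSource` — both what p. 266's analytic alternative provides).
v6 (append-only; v1–v5 declarations byte-identical; + import `…B13NodeTorusFamily`, dag-p2's (R1) N10-side socket p413625): §9 —
**`b12_main_of_up_frameOf_of_b13Family_eHolo`** ((iv⁵)): the `h3` slot of (iv⁗′) FILLED from the (R1) HISTORY-INDEXED B13 FAMILY PREDICATE
`∀ k v, v ∈ FlowStep.Box γ₁₃ k → Lemma1Printed (S13 k v) c13 ∧ Lemma2Printed … ∧ Lemma3Printed …` (dagwriter's word for the re-typed `b13` leaf,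
TS-3) at the run's coupling history with the last coordinate as the variable — `B13NodeTorusFamily.lemma3_at_update` — with the step family
`S k g := S13 k (update (prefixOf T.flow.g k) (last k) g)`.  When `DagDischargedII` re-types `b13` to that predicate, `hfam` := `(w.up P).b13`.
-/

noncomputable section

namespace Literature.MathematicalPhysics.QuantumFieldTheory.Balaban1983to89.B12NodeKnit

open DagBinding DagDischargedII Node00
open B12RegularSpaces111 (Model)
open B12Lemma4ConcreteFrame (Lemma4Data frameOf lemma4Printed_frameOf)
open B12StepObligation (RunDict sec2Reduction_holds smallFieldStep_iff_steps)
open Step (SFTower SFConsts SFHyp SFNewTerm)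

/-! ## §1. Leaf level: the `b12` leaf of the N-binding at a bundle whose B12 group is a concrete Lemma-4 frame -/

section Leaf

variable (X : PrintedCarriersR) (Y : PrintedCarriers9X) (Z : PrintedCarriers11) (V : PrintedCarriers14R) (W : PrintedCarriers15)

/-- **The own leaf of N09 at the N-binding is Lemma 4 over the bundle's B12 group** (`rfl`): `(ofPrintedAllXPN X Y Z V W).b12 =
B12Sec2to5.Lemma4Printed X.F12 X.c12` (the `withB4`∕`withB6` re-bindings and the R∕X∕All extensions never touch `b12`,
`DagDischargedII.ofPrintedAllXPN_leaves`). [cite: Balaban1987RG1, Lemma 4 (3.53) p.280 (the leaf's statement; bookkeeping)] -/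
theorem b12_leaf_eq : (Upstream.ofPrintedAllXPN X Y Z V W).b12 = B12Sec2to5.Lemma4Printed X.F12 X.c12 := rfl

/-- Likewise the in-edge leaf `b13` is the [Balaban1988RG2Cluster] triple over the bundle's B13 group (`rfl`). [cite: Balaban1988RG2Cluster, Lemmas 1–3 pp.9, 11, 20 (the leaf's statement; bookkeeping)] -/
theorem b13_leaf_eq :
    (Upstream.ofPrintedAllXPN X Y Z V W).b13 =
      (B13.Lemma1Printed X.S13 X.c13 ∧ B13.Lemma2Printed X.S13 X.c13 ∧ B13.Lemma3Printed X.S13 X.c13) := rfl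

variable {X} {Q : Params} {i : ℕ} {𝔸 : Type} [NormedRing 𝔸] [NormedAlgebra ℂ 𝔸] [CompleteSpace 𝔸] [NormOneClass 𝔸] {𝓜 : Model 𝔸}

/-- **CONJUNCT 1 AT A PINNED BUNDLE — Lemma 4 (3.53) p. 280 BY NAME.**  If the bundle's B12 frame IS the concrete frame of a package `D` of the
by-reference inputs of the proof of Lemma 4 (`X.F12 = frameOf 𝓜 X.c12 D`), the `b12` leaf of the N-binding HOLDS:
`B12Lemma4ConcreteFrame.lemma4Printed_frameOf D` (for `𝐔 ∈ U′ᶜ_{k+1}(□₀, (1+2β)α₀, (1+2β)α₁)`, `𝐀` in (3.31), `τ ∈ [0,1]`, `|B′| < α₃`: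
`(U_j(□₀, exp i(τB + B′)), J_j(□₀, ·))|_X ∈ Uᶜ_j(X, α₀, α₁)` under «all the restrictions», and analyticity on these spaces).
[cite: Balaban1987RG1, Lemma 4 (3.53) p.280] -/
theorem b12_leaf_of_frameOf (D : Lemma4Data Q i 𝓜 X.c12) (hF : X.F12 = frameOf 𝓜 X.c12 D) :
    (Upstream.ofPrintedAllXPN X Y Z V W).b12 := by
  rw [b12_leaf_eq, hF]
  exact lemma4Printed_frameOf D

/-- The same in STRUCTURE-UPDATE form (what a Stage-4∕5 `withB12OfRecord X … := {X with F12 := frameOf 𝓜 c D, c12 := c}` unfolds to): the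
`b12` leaf of the N-binding over the bundle `X` with its B12 group := `(frameOf 𝓜 c D, c)` HOLDS, for every package `D`.
[cite: Balaban1987RG1, Lemma 4 (3.53) p.280] -/
theorem b12_leaf_update (X : PrintedCarriersR) (c : B12Sec2to5.Lemma4Consts) (D : Lemma4Data Q i 𝓜 c) :
    (Upstream.ofPrintedAllXPN { X with F12 := frameOf 𝓜 c D, c12 := c } Y Z V W).b12 :=
  lemma4Printed_frameOf D

end Leaf

/-! ## §2. Run level: at a run whose bundle pins the B12 group, N09 IS its C-bound half (conjunct 1 discharged) -/

section Run

variable {w : WorldP} {P : B12.RunParams} {X : PrintedCarriersR} {Y : PrintedCarriers9X} {Z : PrintedCarriers11}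
  {V : PrintedCarriers14R} {W : PrintedCarriers15} (hP : w.up P = Upstream.ofPrintedAllXPN X Y Z V W)
  {Q : Params} {i : ℕ} {𝔸 : Type} [NormedRing 𝔸] [NormedAlgebra ℂ 𝔸] [CompleteSpace 𝔸] [NormOneClass 𝔸] {𝓜 : Model 𝔸}
  (D : Lemma4Data Q i 𝓜 X.c12) (hF : X.F12 = frameOf 𝓜 X.c12 D)

include hP hF in
/-- The run's `b12` leaf holds (conjunct 1 of N09 at the run, discharged by Lemma 4 on the pinned frame). [cite: Balaban1987RG1, Lemma 4 (3.53) p.280] -/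
theorem b12_of_up_frameOf : (leavesP w P).b12 := by
  show (w.up P).b12
  rw [hP]
  exact b12_leaf_of_frameOf Y Z V W D hF

include hP hF in
/-- **N09 AT A PINNED RUN IS EXACTLY ITS C-BOUND HALF.**  With the B12 group pinned to a concrete Lemma-4 frame, `Dag.B12_main (leavesP w P)` ↔
«the in-edges `b4 … b11` (N01–N08) and `b13` (N10) of the run ⇒ Theorem 1∕3 for the run: `0 < g_k ≤ γ` (k ≤ K) ⇒ the inductive assumptions
(1.1)–(1.22) hold for every `A_k`, k ≤ K» — a statement about the construction `w.C P` alone.  (p. 264 Thm 3: *«if … 0 < g_k ≤ γ for k = 0, 1, …, K,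
then the sequence of actions A_k … satisfy all the inductive assumptions described between (1.1)–(1.22)»*.) [cite: Balaban1987RG1, Thm 1 p.259, Thm 3 p.264] -/
theorem b12_main_iff_thm3_of_up_frameOf :
    Dag.B12_main (leavesP w P) ↔
      ((w.up P).b4 → (w.up P).b5 → (w.up P).b6 → (w.up P).b7 → (w.up P).b8 → (w.up P).b9 → (w.up P).b10 →
        (w.up P).b11 → (w.up P).b13 →
          ((w.C P).flow.InInterval w.γ P.K → ∀ k, k ≤ P.K → (w.C P).IndAss k)) := by
  have h12 : (w.up P).b12 := b12_of_up_frameOf hP D hF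
  rw [b12_main_iff]
  constructor
  · intro h h4 h5 h6 h7 h8 h9 h10 h11 h13
    exact (h h4 h5 h6 h7 h8 h9 h10 h11).2 h12 h13
  · intro h h4 h5 h6 h7 h8 h9 h10 h11
    exact ⟨h12, fun _ h13 => h h4 h5 h6 h7 h8 h9 h10 h11 h13⟩

include hP hF in
/-- **N09 at a pinned run from its Theorem-3 clause as ONE hypothesis** (literal form: given the in-edge `b13`, the interval hypothesis on the
run's couplings implies the inductive assumptions at every `k ≤ K`).  The in-edges `b4 … b11` are not used. [cite: Balaban1987RG1, Thm 1 p.259, Thm 3 p.264] -/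
theorem b12_main_of_up_frameOf_of_thm3
    (hT : (w.up P).b13 → (w.C P).flow.InInterval w.γ P.K → ∀ k, k ≤ P.K → (w.C P).IndAss k) :
    Dag.B12_main (leavesP w P) :=
  (b12_main_iff_thm3_of_up_frameOf hP D hF).2 fun _ _ _ _ _ _ _ _ h13 => hT h13

/-! ## §3. Conjunct 2 in the tree's vocabularies: [II]'s step node; the §2 reduction of [I]; the small-field tower -/

include hP hF in
/-- **(i) Via [II]'s delivered node** ([Balaban1988RG2Cluster] p. 22 *«The above remark completes the proof of the inductive assumptions for the
action A_{k+1}, hence the proof of Theorem I.3.»*): the FIRST STEP `IndAss 0` under the interval hypothesis («A₀ = −(1∕g₀²)A has no terms»,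
(0.17)) and the small-field INDUCTIVE STEP `B13.SmallFieldStep` for the run — the latter GIVEN the in-edge `b13` ([II]'s Lemmas 1–3 over the
run's B13 group) — give N09 at the pinned run, by `B13.indAss_all` (induction on `k`). [cite: Balaban1988RG2Cluster, p.22 (proof of Thm I.3)] -/
theorem b12_main_of_up_frameOf_of_smallFieldStep
    (h0 : (w.C P).flow.InInterval w.γ P.K → (w.C P).IndAss 0)
    (hstep : (w.up P).b13 → B13.SmallFieldStep (w.C P).toRunData P.K w.γ) :
    Dag.B12_main (leavesP w P) :=
  b12_main_of_up_frameOf_of_thm3 hP D hF fun h13 hg =>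
    B13.indAss_all (w.C P).toRunData P.K w.γ (h0 hg) (hstep h13) hg

include hP hF in
/-- **(ii) Via the §2 reduction of [I]** (p. 268 *«By the inductive assumption, and by the properties of the expressions given by explicit
formulas, all terms in this representation satisfy the required properties, except possibly the last term (2.13) in the sum.»*, p. 269 *«Thus the
proof of Theorem 3 is reduced to proving the remaining properties of (2.13), i.e. to a construction of the representation (1.7) with terms having
the analytic extensions satisfying the bound (1.18).»*): for ANY reading `NewTerm (k+1)` of «(2.13) has the representation (1.7) with analytic
terms satisfying (1.18)», the first step + `B12Sec2to5.Sec2Reduction` + the delivery `B12Sec2to5.NewTermDelivered` of the new term (the content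
of §§3–5 of [I] + [II], GIVEN `b13`) give N09 at the pinned run (`B12Sec2to5.smallFieldStep_of_sec2`, `B13.indAss_all`).
[cite: Balaban1987RG1, §2 pp.268–269 (reduction of Thm 3 to (2.13))] -/
theorem b12_main_of_up_frameOf_of_sec2 (NewTerm : ℕ → Prop)
    (h0 : (w.C P).flow.InInterval w.γ P.K → (w.C P).IndAss 0)
    (hred : B12Sec2to5.Sec2Reduction (w.C P).toRunData NewTerm P.K w.γ)
    (hnew : (w.up P).b13 → B12Sec2to5.NewTermDelivered (w.C P).toRunData NewTerm P.K w.γ) :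
    Dag.B12_main (leavesP w P) :=
  b12_main_of_up_frameOf_of_smallFieldStep hP D hF h0 fun h13 =>
    B12Sec2to5.smallFieldStep_of_sec2 (w.C P).toRunData NewTerm P.K w.γ hred (hnew h13)

include hP hF in
/-- **(iii) Via the small-field tower** (the shape NODE 00's Stage-5 construction is to instantiate: `IndAss k := Step.SFHyp T c k`).  If the run's
data are bound to a tower `T` by `B12StepObligation.RunDict` (same coupling flow; `IndAss k ↔ SFHyp T c k`) with `c.γ = w.γ`, then the first step is
AUTOMATIC (`Step.SFHyp.zero`: A₀ has no terms), the §2 reduction HOLDS (`B12StepObligation.sec2Reduction_holds`: the old terms are unchanged), and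
N09 at the pinned run follows from the PER-STEP NEW-TERM OBLIGATIONS `SFHyp T c k → SFNewTerm T c k` (k < K, couplings `0 < g_j ≤ γ`, j ≤ k+1)
GIVEN the in-edge `b13` — the one remaining content (assembled per step from [II]'s deliverables by `B12StepObligation.sfNewTerm_of_deliverables`).
[cite: Balaban1987RG1, Thm 3 p.264 with §2 pp.268–269; Balaban1988RG2Cluster, p.22] -/
theorem b12_main_of_up_frameOf_of_runDict {Q' : Params} {G : Type*} [GaugeGroup G] {Φ 𝒢 : Type*} {T : SFTower Q' G Φ 𝒢}
    {c : SFConsts} (hD : RunDict (w.C P).toRunData T c) (hγ : c.γ = w.γ)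
    (hsteps : (w.up P).b13 → ∀ k, k < P.K → T.flow.InInterval c.γ (k + 1) → SFHyp T c k → SFNewTerm T c k) :
    Dag.B12_main (leavesP w P) := by
  refine b12_main_of_up_frameOf_of_smallFieldStep hP D hF (fun _ => (hD.indAss_iff 0).2 (SFHyp.zero T c)) fun h13 => ?_
  rw [← hγ]
  exact (smallFieldStep_iff_steps hD P.K).2 (hsteps h13)

include hP hF in
/-- (iii′) The same with the §2 reduction DISPLAYED: under `RunDict`, `Sec2Reduction` for the reading `NewTerm (k+1) := SFNewTerm T c k` is a
theorem (`sec2Reduction_holds`), so of the two factors of (ii) only `NewTermDelivered` carries content. [cite: Balaban1987RG1, §2 pp.268–269] -/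
theorem b12_main_of_up_frameOf_of_runDict_newTerm {Q' : Params} {G : Type*} [GaugeGroup G] {Φ 𝒢 : Type*} {T : SFTower Q' G Φ 𝒢}
    {c : SFConsts} (hD : RunDict (w.C P).toRunData T c) (hγ : c.γ = w.γ)
    (hnew : (w.up P).b13 → B12Sec2to5.NewTermDelivered (w.C P).toRunData (fun j => SFNewTerm T c (j - 1)) P.K c.γ) :
    Dag.B12_main (leavesP w P) := by
  refine b12_main_of_up_frameOf_of_sec2 hP D hF (fun j => SFNewTerm T c (j - 1))
    (fun _ => (hD.indAss_iff 0).2 (SFHyp.zero T c)) ?_ ?_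
  · rw [← hγ]; exact sec2Reduction_holds hD P.K
  · rw [← hγ]; exact hnew

include hP hF in
/-- **(iv) THE WHOLE CHAIN BY NAME** (every input of conjunct 2 displayed, as in `B12StepObligation.b12Thm3Shape_of_deliverables` but at the
DAG node): at a pinned run whose construction is bound to a tower (`RunDict`, `c.γ = w.γ`), IF for every step `k < K` — given the inductive
hypotheses at `k`, the interval hypothesis up to `k+1` and the in-edge `b13` — [II] delivers its clauses `B13.Deliverables` for the step data
`S k g` at every coupling value `g ∈ [0, γ]` (pp. 15, 21–22), with the representation (I.1.7) and gauge invariance read at every `g`, the step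
carriers are bound to the tower in the representation (I.1.6) (`StepDict`, `F = Etot`), the constants compare, the couplings obey (0.20)∕(2.15)
(the world leaf `rgFlow`), the spaces `Uᶜ_{k+1}` are gauge invariant by definition (p. 263), `β_{k+1}` is the second moment (5.42) of a kernel
obeying (5.10) (§5), AND the UNSOURCED smoothness clause of p. 264 holds (`BetaSmoothAt`; cell GAPS G-b12-2 (ii) ∕ G-adv2-3) — THEN N09 holds at
the run.  Kernel-checked composition of `sfNewTerm_of_deliverables` per step with (iii). [cite: Balaban1987RG1, Thm 3 p.264, (2.15) p.268, p.263–264, (5.10) p.293, (5.42) p.297; Balaban1988RG2Cluster, pp.15, 21–22] -/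
theorem b12_main_of_up_frameOf_of_deliverables {Q' : Params} {G : Type*} [GaugeGroup G] {Φ 𝒢 : Type*} {T : SFTower Q' G Φ 𝒢}
    {c : SFConsts} (hD : RunDict (w.C P).toRunData T c) (hγ : c.γ = w.γ)
    (S : ℕ → ℝ → B13.StepData) (c13 : B13.Consts) (Δ : ∀ k, B12StepObligation.StepDict T c k (S k))
    (hFk : ∀ k g, (Δ k).F g = (S k g).Etot) (hc : B12StepObligation.ConstsCompare c13 c)
    (hdel : (w.up P).b13 → ∀ k, k < P.K → SFHyp T c k → T.flow.InInterval c.γ (k + 1) →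
      ∀ g, 0 ≤ g → g ≤ c.γ → B13.Deliverables (S k g) c13)
    (hrepr : ∀ k g, (S k g).Repr17) (hgauge : ∀ k g X', (S k g).GaugeInv ((S k g).Etot X'))
    (hrg : (leavesP w P).rgFlow)
    (hsp : ∀ k, k < P.K → B12StepObligation.SpacesGaugeInvariant T c (k + 1))
    (hβ : ∀ k, k < P.K → B12StepObligation.Beta542Source T c k)
    (hsmooth : ∀ k, k < P.K → B12StepObligation.BetaSmoothAt T c k) :
    Dag.B12_main (leavesP w P) := by
  refine b12_main_of_up_frameOf_of_runDict hP D hF hD hγ fun h13 k hk hI hH => ?_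
  have hrgT : T.flow.SatisfiesRG P.K := by
    rw [← hD.flow_eq]
    exact hrg
  exact B12StepObligation.sfNewTerm_of_deliverables (Δ k) (hFk k) hc (hdel h13 k hk hH hI) (hrepr k) (hgauge k)
    (B12StepObligation.rg_of_satisfiesRG hrgT hk) (hsp k hk) (hβ k hk) (hsmooth k hk)

end Run

/-! ## §2′. World level: the discharge SHAPE over any record predicate pinning the B12 group run by run -/

section World

variable {𝔸 : Type} [NormedRing 𝔸] [NormedAlgebra ℂ 𝔸] [CompleteSpace 𝔸] [NormOneClass 𝔸] (𝓜 : Model 𝔸)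

/-- **WORLD-LEVEL SHAPE (literal C-half).**  For a binding world `w` whose upstream block is, at EVERY run, the N-binding over a bundle whose B12
group is a concrete Lemma-4 frame (the lattice `Q`, scale index `i`, bundle and package may depend on the run — the shape a Stage-4∕5
`IsWorldOfRecord` predicate pinning the B12 group will have), N09 holds at every run as soon as the Theorem-3 clause holds for the construction
`w.C` at every run given `b13` — the venue slot `YMDAG.N09_holds (w) (hw) (P)` becomes this one-liner once `hw` supplies `hpin` and `hT`.
[cite: Balaban1987RG1, Lemma 4 p.280, Thm 3 p.264] -/
theorem b12_main_of_pinnedB12_of_thm3 (w : WorldP)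
    (hpin : ∀ P : B12.RunParams, ∃ (Q : Params) (i : ℕ) (X : PrintedCarriersR) (Y : PrintedCarriers9X) (Z : PrintedCarriers11)
      (V : PrintedCarriers14R) (W : PrintedCarriers15) (D : Lemma4Data Q i 𝓜 X.c12),
        w.up P = Upstream.ofPrintedAllXPN X Y Z V W ∧ X.F12 = frameOf 𝓜 X.c12 D)
    (hT : ∀ P : B12.RunParams, (w.up P).b13 → (w.C P).flow.InInterval w.γ P.K → ∀ k, k ≤ P.K → (w.C P).IndAss k) :
    ∀ P : B12.RunParams, Dag.B12_main (leavesP w P) := by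
  intro P
  obtain ⟨Q, i, X, Y, Z, V, W, D, hP, hF⟩ := hpin P
  exact b12_main_of_up_frameOf_of_thm3 hP D hF (hT P)

/-- **WORLD-LEVEL SHAPE ([II]'s node form).**  Same, with the C-half supplied as the first step `IndAss 0` under the interval hypothesis and [II]'s
small-field inductive step `B13.SmallFieldStep` for every run, given `b13`. [cite: Balaban1988RG2Cluster, p.22 (proof of Thm I.3); Balaban1987RG1, Thm 3 p.264] -/
theorem b12_main_of_pinnedB12_of_smallFieldStep (w : WorldP)
    (hpin : ∀ P : B12.RunParams, ∃ (Q : Params) (i : ℕ) (X : PrintedCarriersR) (Y : PrintedCarriers9X) (Z : PrintedCarriers11)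
      (V : PrintedCarriers14R) (W : PrintedCarriers15) (D : Lemma4Data Q i 𝓜 X.c12),
        w.up P = Upstream.ofPrintedAllXPN X Y Z V W ∧ X.F12 = frameOf 𝓜 X.c12 D)
    (h0 : ∀ P : B12.RunParams, (w.C P).flow.InInterval w.γ P.K → (w.C P).IndAss 0)
    (hstep : ∀ P : B12.RunParams, (w.up P).b13 → B13.SmallFieldStep (w.C P).toRunData P.K w.γ) :
    ∀ P : B12.RunParams, Dag.B12_main (leavesP w P) := by
  intro P
  obtain ⟨Q, i, X, Y, Z, V, W, D, hP, hF⟩ := hpin P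
  exact b12_main_of_up_frameOf_of_smallFieldStep hP D hF (h0 P) (hstep P)

end World

/-! ## §4. The Stage-3 frame: at a run of a Stage-3 world of record the B12 group and the construction are FREE -/

section Stage3

variable (θ : Stage3Params) (X : PrintedCarriersR)

/-- The B12 group of the Stage-3 bundle of record `carriers₃ θ X` is `X`'s own (FREE at Stage 3; `rfl`): the B4, B5, B7 and k-level B6
substitutions do not touch it. [cite: Balaban1987RG1, Lemma 4 p.280 (dictionary, bookkeeping)] -/
theorem carriers₃_groupB12 : (carriers₃ θ X).F12 = X.F12 ∧ (carriers₃ θ X).c12 = X.c12 := ⟨rfl, rfl⟩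

/-- Likewise the B13 group (FREE at Stage 3; `rfl`). [cite: Balaban1988RG2Cluster, Lemmas 1–3 pp.9–20 (dictionary, bookkeeping)] -/
theorem carriers₃_groupB13 : (carriers₃ θ X).S13 = X.S13 ∧ (carriers₃ θ X).c13 = X.c13 := ⟨rfl, rfl⟩

variable {θ X} {Y : PrintedCarriers9X} {Z : PrintedCarriers11} {V : PrintedCarriers14R} {W : PrintedCarriers15}
  (hθ : θ.toStage1Params.Admissible) {w : WorldP} {P : B12.RunParams}
  (hP : w.up P = Upstream.ofPrintedAllXPN (carriers₃ θ X) Y Z V W)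

include hθ hP in
/-- **N09 at a run of a Stage-3 world of record, UNFOLDED** (the in-edge vacuity map of YM-PLAN §1 for N09): with `b4`, `b5`, `b7` discharged at the
objects of record (`carriers₁_b4`, `carriers₁_b5`, `carriers₂_b7`), `Dag.B12_main (leavesP w P)` ↔ «`b6 → b8 → b9 → b10 → b11` of the run's bundle ⇒
(Lemma 4 on the run's FREE frame `X.F12 X.c12`) ∧ (Lemma 4 → `b13` → the Theorem-3 clause for the FREE construction `w.C P`)» — neither conjunct is
decided by Stage ≤ 3, which is why §2–§3 carry the B12 pin and the C-half as explicit hypotheses. [cite: Balaban1987RG1, Lemma 4 p.280, Thm 3 p.264 (dictionary, bookkeeping)] -/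
theorem b12_main_iff_of_up_carriers₃ :
    Dag.B12_main (leavesP w P) ↔
      ((Upstream.ofPrintedAllXPN (carriers₃ θ X) Y Z V W).b6 → (Upstream.ofPrintedAllXPN X Y Z V W).b8 →
        (Upstream.ofPrintedAllXPN X Y Z V W).b9 → (Upstream.ofPrintedAllXPN X Y Z V W).b10 →
          (Upstream.ofPrintedAllXPN X Y Z V W).b11 →
            (B12Sec2to5.Lemma4Printed X.F12 X.c12 ∧
              (B12Sec2to5.Lemma4Printed X.F12 X.c12 → (Upstream.ofPrintedAllXPN X Y Z V W).b13 →
                ((w.C P).flow.InInterval w.γ P.K → ∀ k, k ≤ P.K → (w.C P).IndAss k)))) := by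
  have h4 : (w.up P).b4 := by rw [hP]; exact carriers₁_b4 θ.toStage1Params hθ _ Y Z V W
  have h5 : (w.up P).b5 := by rw [hP]; exact carriers₁_b5 θ.toStage1Params hθ _ Y Z V W
  have h7 : (w.up P).b7 := by rw [hP]; exact carriers₂_b7 θ.toStage2Params _ Y Z V W
  rw [b12_main_iff]
  rw [hP] at h4 h5 h7 ⊢
  exact ⟨fun h h6 h8 h9 h10 h11 => h h4 h5 h6 h7 h8 h9 h10 h11, fun h _ _ h6 _ h8 h9 h10 h11 => h h6 h8 h9 h10 h11⟩

end Stage3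

/-! ## §5 (v2, append-only). Two per-step inputs of (iv) in their printed readings, and the node's link to THEOREM 1 AS PRINTED -/

section Inputs
/-- **«The spaces Uᶜ_j(X, α₀, α₁) are, by the definition, gauge invariant» (p. 263) DISCHARGED for concrete towers**: if the tower's domains at
index `j` ARE `B12RegularSpaces111.space` (unions of `Gᶜ`-orbits of pairs satisfying (i)–(iv), p. 262) and its action (1.10) is `B12RegularSpaces111.act`
through a `Gᶜ`-valued reading of `𝒢`, then `SpacesGaugeInvariant T c j` — by `B12RegularSpaces111.act_mem_space`; removes `hsp` of (iv) for such
towers. [cite: Balaban1987RG1, p.262–263 (definition of Uᶜ_j; «by the definition, gauge invariant»)] -/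
theorem spacesGaugeInvariant_of_space {Q : Params} {G : Type*} [GaugeGroup G] {𝒢 : Type*} {Q' : Params} {i : ℕ} {𝔸 : Type}
    [NormedRing 𝔸] [NormedAlgebra ℂ 𝔸] [CompleteSpace 𝔸] (𝓜 : Model 𝔸) (T : SFTower Q G (FieldPair Q' i 𝔸ˣ 𝔸) 𝒢)
    (c : SFConsts) (j : ℕ) (Fr : (T.sys j).Dom → B12RegularSpaces111.Frame Q' i 𝔸) (cs : (T.sys j).Dom → B12RegularSpaces111.StepConsts)
    (γ₀ : (T.sys j).Dom → ℝ) (toGauge : 𝒢 → Site Q' i → 𝔸ˣ) (hG : ∀ u x, toGauge u x ∈ 𝓜.Gc)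
    (hspace : ∀ X, T.space j X c.α₀ c.α₁ = B12RegularSpaces111.space 𝓜 (Fr X) (cs X) c.α₀ c.α₁ (γ₀ X))
    (hact : ∀ u φ, T.act u φ = B12RegularSpaces111.act (toGauge u) φ) :
    B12StepObligation.SpacesGaugeInvariant T c j := by
  intro X u φ hφ
  rw [hspace X] at hφ ⊢
  rw [hact]
  exact B12RegularSpaces111.act_mem_space hφ (hG u)

variable {w : WorldP} {P : B12.RunParams} {X : PrintedCarriersR} {Y : PrintedCarriers9X} {Z : PrintedCarriers11}
  {V : PrintedCarriers14R} {W : PrintedCarriers15} (hP : w.up P = Upstream.ofPrintedAllXPN X Y Z V W)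
  {Q : Params} {i : ℕ} {𝔸 : Type} [NormedRing 𝔸] [NormedAlgebra ℂ 𝔸] [CompleteSpace 𝔸] [NormOneClass 𝔸] {𝓜 : Model 𝔸}
  (D : Lemma4Data Q i 𝓜 X.c12) (hF : X.F12 = frameOf 𝓜 X.c12 D)

include hP hF in
/-- **(iv′) The whole chain in the «(or analytic)» reading of the β-clause** (p. 264 *«smooth … (or analytic)»*, p. 266 *«E^{(j)}, β_j are analytic
functions of the effective coupling constants»*): (iv) with the UNSOURCED smoothness clause supplied by real-analyticity of `β_{k+1}` on `[0, γ]`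
(`B12BetaSmooth.BetaAnalyticAt`, equally unproved in §§2–5 ∕ [II]) via `betaSmoothAt_of_analytic` (`γ > 0`). [cite: Balaban1987RG1, p.264 (β-clause) with p.266] -/
theorem b12_main_of_up_frameOf_of_deliverables_analytic {Q' : Params} {G : Type*} [GaugeGroup G] {Φ 𝒢 : Type*}
    {T : SFTower Q' G Φ 𝒢} {c : SFConsts} (hD : RunDict (w.C P).toRunData T c) (hγ : c.γ = w.γ) (hγ0 : 0 < c.γ)
    (S : ℕ → ℝ → B13.StepData) (c13 : B13.Consts) (Δ : ∀ k, B12StepObligation.StepDict T c k (S k))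
    (hFk : ∀ k g, (Δ k).F g = (S k g).Etot) (hc : B12StepObligation.ConstsCompare c13 c)
    (hdel : (w.up P).b13 → ∀ k, k < P.K → SFHyp T c k → T.flow.InInterval c.γ (k + 1) →
      ∀ g, 0 ≤ g → g ≤ c.γ → B13.Deliverables (S k g) c13)
    (hrepr : ∀ k g, (S k g).Repr17) (hgauge : ∀ k g X', (S k g).GaugeInv ((S k g).Etot X'))
    (hrg : (leavesP w P).rgFlow)
    (hsp : ∀ k, k < P.K → B12StepObligation.SpacesGaugeInvariant T c (k + 1))
    (hβ : ∀ k, k < P.K → B12StepObligation.Beta542Source T c k)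
    (han : ∀ k, k < P.K → B12BetaSmooth.BetaAnalyticAt T c k) :
    Dag.B12_main (leavesP w P) :=
  b12_main_of_up_frameOf_of_deliverables hP D hF hD hγ S c13 Δ hFk hc hdel hrepr hgauge hrg hsp hβ
    fun k hk => B12BetaSmooth.betaSmoothAt_of_analytic hγ0 (han k hk)

/-- **The innermost clause of [I] THEOREM 3 for the world's construction from the node**: N09 at EVERY run of `w` + its in-edges `b4 … b11`,
`b13` at every run ⇒ every run in the interval ]0, w.γ] satisfies the inductive assumptions at every `k ≤ K` (the shape of
`B12.thm1_of_thm3_fixedConsts` ∕ `B13.thm3_inner_of_step`).  Pure logic. [cite: Balaban1987RG1, Thm 3 p.264] -/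
theorem thm3_inner_of_b12_main (w : WorldP) (hN : ∀ P : B12.RunParams, Dag.B12_main (leavesP w P))
    (hin : ∀ P : B12.RunParams, (w.up P).b4 ∧ (w.up P).b5 ∧ (w.up P).b6 ∧ (w.up P).b7 ∧ (w.up P).b8 ∧ (w.up P).b9 ∧
      (w.up P).b10 ∧ (w.up P).b11 ∧ (w.up P).b13) :
    ∀ P : B12.RunParams, (w.C P).flow.InInterval w.γ P.K → ∀ k, k ≤ P.K → (w.C P).IndAss k := by
  intro P hI k hk
  obtain ⟨h4, h5, h6, h7, h8, h9, h10, h11, h13⟩ := hin P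
  have h := hN P h4 h5 h6 h7 h8 h9 h10 h11
  exact h.2 h.1 h13 hI k hk

/-- **THE NODE IMPLIES [I] THEOREM 1 AS PRINTED FOR THE WORLD'S CONSTRUCTION**: with moreover `0 < w.γ` and the reading `IndAss k → Repr k`
(p. 260 (1.3)∕(1.6) ⊇ (0.22)–(0.24), (0.29); `hIncl` of `B12.thm1_of_thm3_fixedConsts`), `B12.Thm1Printed w.C.toB12` (*«If the sequence of the
effective coupling constants is contained in an interval ]0, γ] …, then the effective actions for small fields are given by the formulas
(0.22)–(0.24), with terms satisfying (0.29).»*), witness the world's `γ`. [cite: Balaban1987RG1, Thm 1 p.259 (with p.264 «a precise version of Theorem 1»)] -/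
theorem thm1Printed_of_b12_main (w : WorldP) (hγ : 0 < w.γ) (hN : ∀ P : B12.RunParams, Dag.B12_main (leavesP w P))
    (hin : ∀ P : B12.RunParams, (w.up P).b4 ∧ (w.up P).b5 ∧ (w.up P).b6 ∧ (w.up P).b7 ∧ (w.up P).b8 ∧ (w.up P).b9 ∧
      (w.up P).b10 ∧ (w.up P).b11 ∧ (w.up P).b13)
    (hIncl : ∀ (P : B12.RunParams) (k : ℕ), (w.C P).IndAss k → (w.C P).Repr k) : B12.Thm1Printed w.C.toB12 :=
  ⟨w.γ, hγ, fun P hI k hk => hIncl P k (thm3_inner_of_b12_main w hN hin P hI k hk)⟩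

end Inputs

/-! ## §6 (v3, append-only). Conjunct 2's β-side from ONE holomorphic polarization source per step (`B12BetaHolo.PiHoloSource`) -/

section PiHolo

variable {w : WorldP} {P : B12.RunParams} {X : PrintedCarriersR} {Y : PrintedCarriers9X} {Z : PrintedCarriers11}
  {V : PrintedCarriers14R} {W : PrintedCarriers15} (hP : w.up P = Upstream.ofPrintedAllXPN X Y Z V W)
  {Q : Params} {i : ℕ} {𝔸 : Type} [NormedRing 𝔸] [NormedAlgebra ℂ 𝔸] [CompleteSpace 𝔸] [NormOneClass 𝔸] {𝓜 : Model 𝔸}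
  (D : Lemma4Data Q i 𝓜 X.c12) (hF : X.F12 = frameOf 𝓜 X.c12 D)

include hP hF in
/-- **(iv″) THE WHOLE CHAIN with the β-side from ONE holomorphic Π-source per step.**  As (iv) `b12_main_of_up_frameOf_of_deliverables`,
but the two β-inputs of the step — the §5 source `Beta542Source` ((5.42) + (5.10)) AND the UNSOURCED smoothness clause `BetaSmoothAt`
(p. 264 *«It is a smooth function defined on the interval [0, γ], (or analytic), uniformly bounded on this interval together with all
derivatives»*) — are BOTH supplied, at every step `k < K`, by a `B12BetaHolo.PiHoloSource T c k`: the (1.21) kernel `Π^{(k+1)}_{μν}(g, x)`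
is on [0, γ] the real part of a kernel HOLOMORPHIC in the coupling on a complex neighbourhood of [0, γ] obeying (5.10) there — the p. 266
«(or analytic)» alternative (*«the functions E^{(j)}, β_j are analytic functions of the effective coupling constants»*), from which
`B12BetaHolo` DERIVES smoothness, analyticity and all-derivative bounds of `β_{k+1}` by Cauchy's estimates (`PiHoloSource.betaSmoothAt`,
`.toBeta542Source`).  `0 < γ` (p. 263 *«a positive, absolute γ»*).  Kernel-checked composition. [cite: Balaban1987RG1, Thm 3 p.264 with p.264 (β-clause), p.266 (analytic alternative), (5.10) p.293, (5.42) p.297; Balaban1988RG2Cluster, pp.21–22] -/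
theorem b12_main_of_up_frameOf_of_deliverables_piHolo {Q' : Params} {G : Type*} [GaugeGroup G] {Φ 𝒢 : Type*}
    {T : SFTower Q' G Φ 𝒢} {c : SFConsts} (hD : RunDict (w.C P).toRunData T c) (hγ : c.γ = w.γ) (hγ0 : 0 < c.γ)
    (S : ℕ → ℝ → B13.StepData) (c13 : B13.Consts) (Δ : ∀ k, B12StepObligation.StepDict T c k (S k))
    (hFk : ∀ k g, (Δ k).F g = (S k g).Etot) (hc : B12StepObligation.ConstsCompare c13 c)
    (hdel : (w.up P).b13 → ∀ k, k < P.K → SFHyp T c k → T.flow.InInterval c.γ (k + 1) →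
      ∀ g, 0 ≤ g → g ≤ c.γ → B13.Deliverables (S k g) c13)
    (hrepr : ∀ k g, (S k g).Repr17) (hgauge : ∀ k g X', (S k g).GaugeInv ((S k g).Etot X'))
    (hrg : (leavesP w P).rgFlow)
    (hsp : ∀ k, k < P.K → B12StepObligation.SpacesGaugeInvariant T c (k + 1))
    (hPi : ∀ k, k < P.K → B12BetaHolo.PiHoloSource T c k) :
    Dag.B12_main (leavesP w P) :=
  b12_main_of_up_frameOf_of_deliverables hP D hF hD hγ S c13 Δ hFk hc hdel hrepr hgauge hrg hsp
    (fun k hk => (hPi k hk).toBeta542Source) fun k hk => (hPi k hk).betaSmoothAt hγ0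

include hP hF in
/-- **(iv‴) THE CENSUS FORM — what conjunct 2 still consumes at a pinned run over CONCRETE SPACES.**  For a tower whose configurations
are pairs `(𝐔, 𝐉)` (`FieldPair`), whose domains `Uᶜ_j(X, α₀, α₁)` ARE the printed spaces `B12RegularSpaces111.space` (p. 262, unions of
`Gᶜ`-orbits) and whose action (1.10) is `B12RegularSpaces111.act` through a `Gᶜ`-valued reading of `𝒢` — so that p. 263 *«by the
definition, gauge invariant»* is the theorem `spacesGaugeInvariant_of_space` (§5) — N09 at the pinned run follows from: [II]'s delivered
clauses at every step and coupling value GIVEN `b13` (`hdel`, N10's content), the step dictionary `StepDict` with the algebraic clauses and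
constant comparison, the world leaf `rgFlow` ((0.20) = (2.15)), `0 < γ`, and ONE holomorphic Π-source per step (`hPi`).  Every remaining
input of conjunct 2 is thereby NAMED; none is an un-displayed estimate of [I]. [cite: Balaban1987RG1, Thm 3 p.264, p.262–263 (spaces), p.266, (5.10) p.293; Balaban1988RG2Cluster, pp.21–22] -/
theorem b12_main_of_up_frameOf_of_deliverables_space_piHolo {Q' : Params} {G : Type*} [GaugeGroup G] {𝒢 : Type*}
    {Q'' : Params} {i' : ℕ} {𝔸' : Type} [NormedRing 𝔸'] [NormedAlgebra ℂ 𝔸'] [CompleteSpace 𝔸'] (𝓜' : Model 𝔸')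
    {T : SFTower Q' G (FieldPair Q'' i' 𝔸'ˣ 𝔸') 𝒢} {c : SFConsts} (hD : RunDict (w.C P).toRunData T c) (hγ : c.γ = w.γ)
    (hγ0 : 0 < c.γ)
    (Fr : (j : ℕ) → (T.sys j).Dom → B12RegularSpaces111.Frame Q'' i' 𝔸')
    (cs : (j : ℕ) → (T.sys j).Dom → B12RegularSpaces111.StepConsts) (γ₀ : (j : ℕ) → (T.sys j).Dom → ℝ)
    (toGauge : 𝒢 → Site Q'' i' → 𝔸'ˣ) (hG : ∀ u x, toGauge u x ∈ 𝓜'.Gc)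
    (hspace : ∀ j X', T.space j X' c.α₀ c.α₁ = B12RegularSpaces111.space 𝓜' (Fr j X') (cs j X') c.α₀ c.α₁ (γ₀ j X'))
    (hact : ∀ u φ, T.act u φ = B12RegularSpaces111.act (toGauge u) φ)
    (S : ℕ → ℝ → B13.StepData) (c13 : B13.Consts) (Δ : ∀ k, B12StepObligation.StepDict T c k (S k))
    (hFk : ∀ k g, (Δ k).F g = (S k g).Etot) (hc : B12StepObligation.ConstsCompare c13 c)
    (hdel : (w.up P).b13 → ∀ k, k < P.K → SFHyp T c k → T.flow.InInterval c.γ (k + 1) →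
      ∀ g, 0 ≤ g → g ≤ c.γ → B13.Deliverables (S k g) c13)
    (hrepr : ∀ k g, (S k g).Repr17) (hgauge : ∀ k g X', (S k g).GaugeInv ((S k g).Etot X'))
    (hrg : (leavesP w P).rgFlow)
    (hPi : ∀ k, k < P.K → B12BetaHolo.PiHoloSource T c k) :
    Dag.B12_main (leavesP w P) :=
  b12_main_of_up_frameOf_of_deliverables_piHolo hP D hF hD hγ hγ0 S c13 Δ hFk hc hdel hrepr hgauge hrg
    (fun k _ => spacesGaugeInvariant_of_space 𝓜' T c (k + 1) (Fr (k + 1)) (cs (k + 1)) (γ₀ (k + 1)) toGauge hG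
      (hspace (k + 1)) hact) hPi

end PiHolo

/-! ## §7 (v4, append-only). The N10-junction form: `hdel` from [II] Lemma 3 per (k, g ∈ ]0, γ]) + the printed closing chain + the g = 0 endpoint -/

section Junction

variable {w : WorldP} {P : B12.RunParams} {X : PrintedCarriersR} {Y : PrintedCarriers9X} {Z : PrintedCarriers11}
  {V : PrintedCarriers14R} {W : PrintedCarriers15} (hP : w.up P = Upstream.ofPrintedAllXPN X Y Z V W)
  {Q : Params} {i : ℕ} {𝔸 : Type} [NormedRing 𝔸] [NormedAlgebra ℂ 𝔸] [CompleteSpace 𝔸] [NormOneClass 𝔸] {𝓜 : Model 𝔸}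
  (D : Lemma4Data Q i 𝓜 X.c12) (hF : X.F12 = frameOf 𝓜 X.c12 D)

/-- **The per-step [II]-deliverables from LEMMA 3 per (k, g) + the printed closing chain + an endpoint datum at g = 0.**  For a
step-datum family `S k g`: IF for every `k < K` and every `g ∈ ]0, γ]` the in-edge `b13` yields [II] Lemma 3 for `S k g` (`h3` — the (R1)
history-indexed leaf specialised at the run's history with last coordinate `g`; [II] Lemma 2 needs `g ≠ 0`), the restrictions hold (`hR`), the
[26]-resummation (2.38) ⇒ (2.41) holds (`h26`, by reference to Cammarota), the `log Z^{(k)}` half obeys (I.1.18) with ½E₀ at rate δ₀M (`hlog`,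
UNPRINTED in the series — GAPS G-B13-12), the representation (I.1.7), analyticity and gauge invariance hold (`hrepr`, `han`, `hg`), with the two
«last assumptions» and `δ₀M ≥ κ` (`h22 h23 h24`), `0 ≤ E₀` — AND at `g = 0` the record supplies `Deliverables (S k 0)` directly (`h0`; p. 268
*«the expression under the exponential above vanishes at g_k = 0»*: no [II] there) — THEN `hdel` of (iv)∕(iv‴) holds on the CLOSED interval
[0, γ] (the currency of `Step.SFHyp.bound118`, p. 263 *«g_{j−1} ∈ [0, γ]»*).  `B13.deliverables_of_chain` per (k, g); case split at g = 0.
[cite: Balaban1988RG2Cluster, pp.20–22 (Lemma 3 to Thm I.3); Balaban1987RG1, p.263, (2.13) p.268] -/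
theorem hdel_of_lemma3Family {Q' : Params} {G : Type*} [GaugeGroup G] {Φ 𝒢 : Type*} {T : SFTower Q' G Φ 𝒢} {c : SFConsts}
    (S : ℕ → ℝ → B13.StepData) (c13 : B13.Consts)
    (h3 : (w.up P).b13 → ∀ k, k < P.K → SFHyp T c k → T.flow.InInterval c.γ (k + 1) →
      ∀ g, 0 < g → g ≤ c.γ → B13.Lemma3Printed (S k g) c13)
    (hR : ∀ k g, (S k g).Restr) (h26 : ∀ k g, B13.CammarotaStep (S k g) c13)
    (h22 : c13.R22) (h23 : c13.R23) (h24 : c13.R24) (hE₀ : 0 ≤ c13.E₀)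
    (hlog : ∀ k g, B13.Bound118 (S k g).Dk1 (S k g).sp2 (S k g).Elog (c13.E₀ / 2) (c13.δ₀ * c13.M))
    (hrepr : ∀ k g, (S k g).Repr17) (han : ∀ k g X', (S k g).Analytic ((S k g).Etot X') ((S k g).sp2 X'))
    (hg : ∀ k g X', (S k g).GaugeInv ((S k g).Etot X'))
    (h0 : ∀ k, k < P.K → B13.Deliverables (S k 0) c13) :
    (w.up P).b13 → ∀ k, k < P.K → SFHyp T c k → T.flow.InInterval c.γ (k + 1) →
      ∀ g, 0 ≤ g → g ≤ c.γ → B13.Deliverables (S k g) c13 := by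
  intro hb k hk hH hI g hg0 hgγ
  rcases hg0.eq_or_lt with h | h
  · rw [← h]
    exact h0 k hk
  · exact B13.deliverables_of_chain (S k g) c13 (hR k g) (h3 hb k hk hH hI g h hgγ) (h26 k g) h22 h23 h24 hE₀
      (hlog k g) (hrepr k g) (han k g) (hg k g)

include hP hF in
/-- **(iv⁗) THE N10-JUNCTION FORM OF N09** (TS-3, consumer side): at a run pinned to a tower over the concrete spaces, `Dag.B12_main (leavesP w P)`
follows from — per step `k < K` and coupling `g ∈ ]0, γ]`: [II] LEMMA 3 for the step datum `S k g` GIVEN the in-edge `b13` (`h3`), the printed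
closing-chain leaves of [II] pp. 20–22 (`hR h26 h22 h23 h24 hE₀ hlog hrepr han hg`), the endpoint data at `g = 0` (`h0`); the step dictionary
(`Δ hFk hc`; note `Repr17`∕`GaugeInv` now enter once, through the chain); the world leaf `rgFlow`; `0 < γ`; and ONE holomorphic Π-source per
step (`hPi`).  When the (R1) re-typing of the B13 group lands, `h3` is the specialisation of `(w.up P).b13` at the run's coupling history — the
junction then consumes the in-edge genuinely. [cite: Balaban1987RG1, Thm 3 p.264 with §2 pp.268–269; Balaban1988RG2Cluster, Lemma 3 p.20 and pp.20–22] -/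
theorem b12_main_of_up_frameOf_of_lemma3Family_piHolo {Q' : Params} {G : Type*} [GaugeGroup G] {𝒢 : Type*}
    {Q'' : Params} {i' : ℕ} {𝔸' : Type} [NormedRing 𝔸'] [NormedAlgebra ℂ 𝔸'] [CompleteSpace 𝔸'] (𝓜' : Model 𝔸')
    {T : SFTower Q' G (FieldPair Q'' i' 𝔸'ˣ 𝔸') 𝒢} {c : SFConsts} (hD : RunDict (w.C P).toRunData T c) (hγ : c.γ = w.γ)
    (hγ0 : 0 < c.γ)
    (Fr : (j : ℕ) → (T.sys j).Dom → B12RegularSpaces111.Frame Q'' i' 𝔸')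
    (cs : (j : ℕ) → (T.sys j).Dom → B12RegularSpaces111.StepConsts) (γ₀ : (j : ℕ) → (T.sys j).Dom → ℝ)
    (toGauge : 𝒢 → Site Q'' i' → 𝔸'ˣ) (hG : ∀ u x, toGauge u x ∈ 𝓜'.Gc)
    (hspace : ∀ j X', T.space j X' c.α₀ c.α₁ = B12RegularSpaces111.space 𝓜' (Fr j X') (cs j X') c.α₀ c.α₁ (γ₀ j X'))
    (hact : ∀ u φ, T.act u φ = B12RegularSpaces111.act (toGauge u) φ)
    (S : ℕ → ℝ → B13.StepData) (c13 : B13.Consts) (Δ : ∀ k, B12StepObligation.StepDict T c k (S k))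
    (hFk : ∀ k g, (Δ k).F g = (S k g).Etot) (hc : B12StepObligation.ConstsCompare c13 c)
    (h3 : (w.up P).b13 → ∀ k, k < P.K → SFHyp T c k → T.flow.InInterval c.γ (k + 1) →
      ∀ g, 0 < g → g ≤ c.γ → B13.Lemma3Printed (S k g) c13)
    (hR : ∀ k g, (S k g).Restr) (h26 : ∀ k g, B13.CammarotaStep (S k g) c13)
    (h22 : c13.R22) (h23 : c13.R23) (h24 : c13.R24) (hE₀ : 0 ≤ c13.E₀)
    (hlog : ∀ k g, B13.Bound118 (S k g).Dk1 (S k g).sp2 (S k g).Elog (c13.E₀ / 2) (c13.δ₀ * c13.M))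
    (hrepr : ∀ k g, (S k g).Repr17) (han : ∀ k g X', (S k g).Analytic ((S k g).Etot X') ((S k g).sp2 X'))
    (hg : ∀ k g X', (S k g).GaugeInv ((S k g).Etot X'))
    (h0 : ∀ k, k < P.K → B13.Deliverables (S k 0) c13)
    (hrg : (leavesP w P).rgFlow)
    (hPi : ∀ k, k < P.K → B12BetaHolo.PiHoloSource T c k) :
    Dag.B12_main (leavesP w P) :=
  b12_main_of_up_frameOf_of_deliverables_space_piHolo hP D hF 𝓜' hD hγ hγ0 Fr cs γ₀ toGauge hG hspace hact S c13 Δ hFk hc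
    (hdel_of_lemma3Family (w := w) (P := P) S c13 h3 hR h26 h22 h23 h24 hE₀ hlog hrepr han hg h0) hrepr hg hrg hPi

end Junction

/-! ## §8 (v5, append-only). The junction without an endpoint datum: (1.18) at g = 0 by continuity from `EHoloAt` -/

section JunctionHolo

variable {w : WorldP} {P : B12.RunParams} {X : PrintedCarriersR} {Y : PrintedCarriers9X} {Z : PrintedCarriers11}
  {V : PrintedCarriers14R} {W : PrintedCarriers15} (hP : w.up P = Upstream.ofPrintedAllXPN X Y Z V W)
  {Q : Params} {i : ℕ} {𝔸 : Type} [NormedRing 𝔸] [NormedAlgebra ℂ 𝔸] [CompleteSpace 𝔸] [NormOneClass 𝔸] {𝓜 : Model 𝔸}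
  (D : Lemma4Data Q i 𝓜 X.c12) (hF : X.F12 = frameOf 𝓜 X.c12 D)

include hP hF in
/-- **(iv⁗′) THE N10-JUNCTION FORM WITH THE ENDPOINT BY CONTINUITY.**  At a run pinned to a tower over the concrete spaces `B12RegularSpaces111.space`,
`Dag.B12_main (leavesP w P)` follows from — per step `k < K` and coupling `g ∈ ]0, γ]`: [II] LEMMA 3 for `S k g` GIVEN the in-edge `b13` (`h3`), the
printed closing-chain leaves (`hR h26 h22 h23 h24 hE₀ hlog hrepr han hg`); the step dictionary (`Δ hFk hc`); the world leaf `rgFlow`; `0 < γ`; and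
per step a holomorphic source for the new TERM (`hE : EHoloAt T c k` — closes the interval at `g = 0` by continuity,
`B12BetaHolo.sfNewTerm_of_deliverables_Ioc`) and for the polarization KERNEL (`hPi : PiHoloSource T c k` — both β-clauses).  No `g = 0` datum.
[cite: Balaban1987RG1, Thm 3 p.264, (1.18) p.263, p.266 (analytic alternative); Balaban1988RG2Cluster, Lemma 3 p.20 and pp.20–22] -/
theorem b12_main_of_up_frameOf_of_lemma3Family_eHolo {Q' : Params} {G : Type*} [GaugeGroup G] {𝒢 : Type*}
    {Q'' : Params} {i' : ℕ} {𝔸' : Type} [NormedRing 𝔸'] [NormedAlgebra ℂ 𝔸'] [CompleteSpace 𝔸'] (𝓜' : Model 𝔸')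
    {T : SFTower Q' G (FieldPair Q'' i' 𝔸'ˣ 𝔸') 𝒢} {c : SFConsts} (hD : RunDict (w.C P).toRunData T c) (hγ : c.γ = w.γ)
    (hγ0 : 0 < c.γ)
    (Fr : (j : ℕ) → (T.sys j).Dom → B12RegularSpaces111.Frame Q'' i' 𝔸')
    (cs : (j : ℕ) → (T.sys j).Dom → B12RegularSpaces111.StepConsts) (γ₀ : (j : ℕ) → (T.sys j).Dom → ℝ)
    (toGauge : 𝒢 → Site Q'' i' → 𝔸'ˣ) (hG : ∀ u x, toGauge u x ∈ 𝓜'.Gc)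
    (hspace : ∀ j X', T.space j X' c.α₀ c.α₁ = B12RegularSpaces111.space 𝓜' (Fr j X') (cs j X') c.α₀ c.α₁ (γ₀ j X'))
    (hact : ∀ u φ, T.act u φ = B12RegularSpaces111.act (toGauge u) φ)
    (S : ℕ → ℝ → B13.StepData) (c13 : B13.Consts) (Δ : ∀ k, B12StepObligation.StepDict T c k (S k))
    (hFk : ∀ k g, (Δ k).F g = (S k g).Etot) (hc : B12StepObligation.ConstsCompare c13 c)
    (h3 : (w.up P).b13 → ∀ k, k < P.K → SFHyp T c k → T.flow.InInterval c.γ (k + 1) →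
      ∀ g, 0 < g → g ≤ c.γ → B13.Lemma3Printed (S k g) c13)
    (hR : ∀ k g, (S k g).Restr) (h26 : ∀ k g, B13.CammarotaStep (S k g) c13)
    (h22 : c13.R22) (h23 : c13.R23) (h24 : c13.R24) (hE₀ : 0 ≤ c13.E₀)
    (hlog : ∀ k g, B13.Bound118 (S k g).Dk1 (S k g).sp2 (S k g).Elog (c13.E₀ / 2) (c13.δ₀ * c13.M))
    (hrepr : ∀ k g, (S k g).Repr17) (han : ∀ k g X', (S k g).Analytic ((S k g).Etot X') ((S k g).sp2 X'))
    (hg : ∀ k g X', (S k g).GaugeInv ((S k g).Etot X'))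
    (hrg : (leavesP w P).rgFlow)
    (hE : ∀ k, k < P.K → B12BetaHolo.EHoloAt T c k)
    (hPi : ∀ k, k < P.K → B12BetaHolo.PiHoloSource T c k) :
    Dag.B12_main (leavesP w P) := by
  refine b12_main_of_up_frameOf_of_runDict hP D hF hD hγ fun h13 k hk hI hH => ?_
  have hrgT : T.flow.SatisfiesRG P.K := by
    rw [← hD.flow_eq]
    exact hrg
  exact B12BetaHolo.sfNewTerm_of_deliverables_Ioc (Δ k) (hFk k) hc
    (fun g hg0 hgγ => B13.deliverables_of_chain (S k g) c13 (hR k g) (h3 h13 k hk hH hI g hg0 hgγ) (h26 k g) h22 h23 h24 hE₀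
      (hlog k g) (hrepr k g) (han k g) (hg k g))
    (hrepr k) (hg k) (B12StepObligation.rg_of_satisfiesRG hrgT hk)
    (spacesGaugeInvariant_of_space 𝓜' T c (k + 1) (Fr (k + 1)) (cs (k + 1)) (γ₀ (k + 1)) toGauge hG (hspace (k + 1)) hact)
    hγ0 (hE k hk) (hPi k hk)

end JunctionHolo

/-! ## §9 (v6, append-only). The junction fed by the (R1) history-indexed B13 family predicate (`B13NodeTorusFamily.lemma3_at_update`) -/

section Family

variable {w : WorldP} {P : B12.RunParams} {X : PrintedCarriersR} {Y : PrintedCarriers9X} {Z : PrintedCarriers11}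
  {V : PrintedCarriers14R} {W : PrintedCarriers15} (hP : w.up P = Upstream.ofPrintedAllXPN X Y Z V W)
  {Q : Params} {i : ℕ} {𝔸 : Type} [NormedRing 𝔸] [NormedAlgebra ℂ 𝔸] [CompleteSpace 𝔸] [NormOneClass 𝔸] {𝓜 : Model 𝔸}
  (D : Lemma4Data Q i 𝓜 X.c12) (hF : X.F12 = frameOf 𝓜 X.c12 D)

include hP hF in
/-- **(iv⁵) N09 FROM THE HISTORY-INDEXED B13 FAMILY** (TS-3 (R1), consumer side complete).  Let `S13 : (k : ℕ) → (Fin (k+1) → ℝ) → B13.StepData`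
be [II]'s step data as a function of the coupling HISTORY (p. 298 *«β_j … depends also on all preceding coupling constants»*), and suppose the
in-edge `b13` yields the family predicate `∀ k v, v ∈ ]0, γ₁₃]^{k+1} → Lemma 1 ∧ Lemma 2 ∧ Lemma 3 for S13 k v` (`hfam`; the re-typed leaf of the
cell's TS-3 word (R1)) with `γ ≤ γ₁₃`.  Read the per-(k, g) step family of (iv⁗′) as `S k g := S13 k (update (prefixOf T.flow.g k) (last k) g)` —
the run's history up to `k` with the LAST coupling replaced by the variable `g` (the currency of (1.18)∕(5.42): functions of `g_k ∈ [0, γ]`).  Then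
the `h3` slot is `B13NodeTorusFamily.lemma3_at_update` (the history prefix lies in the box because the run's couplings do: `InInterval γ (k+1)`),
and N09 at the pinned run follows from the remaining per-(k,g) closing leaves of [II] pp. 20–22, the dictionary, `rgFlow`, `0 < γ`, and per step
ONE `EHoloAt` + ONE `PiHoloSource`. [cite: Balaban1987RG1, Thm 3 p.264, p.298; Balaban1988RG2Cluster, Lemmas 1–3 pp.9, 11, 20 and pp.20–22] -/
theorem b12_main_of_up_frameOf_of_b13Family_eHolo {Q' : Params} {G : Type*} [GaugeGroup G] {𝒢 : Type*}
    {Q'' : Params} {i' : ℕ} {𝔸' : Type} [NormedRing 𝔸'] [NormedAlgebra ℂ 𝔸'] [CompleteSpace 𝔸'] (𝓜' : Model 𝔸')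
    {T : SFTower Q' G (FieldPair Q'' i' 𝔸'ˣ 𝔸') 𝒢} {c : SFConsts} (hD : RunDict (w.C P).toRunData T c) (hγ : c.γ = w.γ)
    (hγ0 : 0 < c.γ)
    (Fr : (j : ℕ) → (T.sys j).Dom → B12RegularSpaces111.Frame Q'' i' 𝔸')
    (cs : (j : ℕ) → (T.sys j).Dom → B12RegularSpaces111.StepConsts) (γ₀ : (j : ℕ) → (T.sys j).Dom → ℝ)
    (toGauge : 𝒢 → Site Q'' i' → 𝔸'ˣ) (hG : ∀ u x, toGauge u x ∈ 𝓜'.Gc)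
    (hspace : ∀ j X', T.space j X' c.α₀ c.α₁ = B12RegularSpaces111.space 𝓜' (Fr j X') (cs j X') c.α₀ c.α₁ (γ₀ j X'))
    (hact : ∀ u φ, T.act u φ = B12RegularSpaces111.act (toGauge u) φ)
    (S13 : (k : ℕ) → (Fin (k + 1) → ℝ) → B13.StepData) (c13 : B13.Consts) {γ13 : ℝ} (hγ13 : c.γ ≤ γ13)
    (hfam : (w.up P).b13 → ∀ k v, v ∈ FlowStep.Box γ13 k →
      B13.Lemma1Printed (S13 k v) c13 ∧ B13.Lemma2Printed (S13 k v) c13 ∧ B13.Lemma3Printed (S13 k v) c13)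
    (Δ : ∀ k, B12StepObligation.StepDict T c k
      (fun g => S13 k (Function.update (FlowStep.prefixOf T.flow.g k) (Fin.last k) g)))
    (hFk : ∀ k g, (Δ k).F g = (S13 k (Function.update (FlowStep.prefixOf T.flow.g k) (Fin.last k) g)).Etot)
    (hc : B12StepObligation.ConstsCompare c13 c)
    (hR : ∀ k v, (S13 k v).Restr) (h26 : ∀ k v, B13.CammarotaStep (S13 k v) c13)
    (h22 : c13.R22) (h23 : c13.R23) (h24 : c13.R24) (hE₀ : 0 ≤ c13.E₀)
    (hlog : ∀ k v, B13.Bound118 (S13 k v).Dk1 (S13 k v).sp2 (S13 k v).Elog (c13.E₀ / 2) (c13.δ₀ * c13.M))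
    (hrepr : ∀ k v, (S13 k v).Repr17) (han : ∀ k v X', (S13 k v).Analytic ((S13 k v).Etot X') ((S13 k v).sp2 X'))
    (hg : ∀ k v X', (S13 k v).GaugeInv ((S13 k v).Etot X'))
    (hrg : (leavesP w P).rgFlow)
    (hE : ∀ k, k < P.K → B12BetaHolo.EHoloAt T c k)
    (hPi : ∀ k, k < P.K → B12BetaHolo.PiHoloSource T c k) :
    Dag.B12_main (leavesP w P) :=
  b12_main_of_up_frameOf_of_lemma3Family_eHolo hP D hF 𝓜' hD hγ hγ0 Fr cs γ₀ toGauge hG hspace hact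
    (fun k g => S13 k (Function.update (FlowStep.prefixOf T.flow.g k) (Fin.last k) g)) c13 Δ hFk hc
    (fun h13 _ _ _ hI => B13NodeTorusFamily.lemma3_at_update hγ13 S13 c13 (hfam h13)
      (fun i hi => hI i (Nat.le_succ_of_le hi)))
    (fun k _ => hR k _) (fun k _ => h26 k _) h22 h23 h24 hE₀ (fun k _ => hlog k _) (fun k _ => hrepr k _)
    (fun k _ X' => han k _ X') (fun k _ X' => hg k _ X') hrg hE hPi

end Family

end Literature.MathematicalPhysics.QuantumFieldTheory.Balaban1983to89.B12NodeKnit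

end
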